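import Summits.CriticalPhenomena.PercolationContinuityZ3.Theorems.PercExchangeRateTransportSubcritExchangeUniformityUpperFenceMono
import Summits.CriticalPhenomena.PercolationContinuityZ3.Theorems.PercExchangeRateTransportSubcritExchangeUniformityLevelTransportMono
import Summits.CriticalPhenomena.PercolationContinuityZ3.Theorems.PercExchangeRateTransportSubcritExchangeUniformityRightCollarModuli

/-!
# The ONE-SIDED transport lemma `transportLemmaMono` (crux `SubcritExchangeUniformity` = K⁻, stmt-CriticalPhenomena-16062,
# line `onesided`, route `PercExchangeRateTransport`)

Percolation-free real analysis, the one-sided sharpening of the route item `TransportLemma`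
(stmt-CriticalPhenomena-16063, proved): for `C¹` functions `Θ n` on the open unit square, nondecreasing in `p`,
nonincreasing in `n`, nonnegative, whose infimum `Θ∞ = ⨅ₙ Θ n` has a continuous threshold curve `pc` on
`[lo,hi] ⊂ (0,1)` with its `ρ`-collar inside the square, a field `a` continuous on the RIGHT closed collar
`{pc t ≤ p ≤ pc t + ρ}` and `L`-Lipschitz in `p` there, the two-sided exchange inequality
`|∂ₜΘ n − a ∂ₚΘ n| ≤ η ∂ₚΘ n` (`n ≥ m(η)`) on the right collar, and BELOW the curve only the ONE-SIDED bound
`(a(pc t,t) − η) ∂ₚΘ n ≤ ∂ₜΘ n` on the `δ(η)`-strip `[pc t − δ, pc t]`: then `t ↦ Θ∞ (pc t) t` is NONINCREASING on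
`[lo,hi]`. (The statement is verbatim the `Prop` `TransportLemmaMono` typed by the crux strategist in
`Cruxes/SubcritExchangeUniformity/Lines/onesided.lean` §5.)

Proof = assembly of the landed helper stubs of this line: Heine–Cantor on the right collar (`rightCollar_moduli`,
p172345) and on the curve (`TransportLemma.pc_modulus`), the FORWARD one-sided upper fence (`upperFenceMono`, p172389:
positivity propagation along test segments of slope `−(a(pc t₀,t₀) − η)`, which uses the lower exchange bound on BOTH
sides of the curve), one-sided level transport above the curve (`levelTransportMono`, p172745: forward Euler polygon of
slope `−(a(vertex)+η)` with free downward restarts, gap recursion `D_{k+1} ≥ (1 − L⁺h)D_k − 2ηh`), and `ε ↓ 0` through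
right-continuity of `q ↦ ⨅ₙ Θ n q s` (`TransportLemma.rightContinuity`). Neither a lower fence, nor `pc ∈ C¹`, nor any
UPPER sub-curve bound, nor monotonicity in `t` is used. Mathlib + tree theorems only; registered helper stub
`transportLemmaMono` of stmt-CriticalPhenomena-16062 (lead c1).
-/

namespace Summit.CriticalPhenomena.PercolationContinuityZ3.Theorems.SubcritExchangeUniformity.TransportMono

open Filter Topology Set
open Summit.CriticalPhenomena.PercolationContinuityZ3.Theorems.TransportLemma (pc_modulus rightContinuity)

/-- **The one-sided transport lemma** (`TransportLemmaMono`): under the right-collar hypotheses of K⁺-type (continuity,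
`L`-Lipschitz in `p`, two-sided exchange inequality for `n ≥ m(η)`) and the ONE-SIDED lower exchange bound
`(a(pc t,t) − η)∂ₚΘ n ≤ ∂ₜΘ n` on the left `δ(η)`-strip, the level function `t ↦ ⨅ₙ Θ n (pc t) t` is nonincreasing on
`[lo,hi]`: `s ≤ t ⇒ ⨅ₙ Θ n (pc t) t ≤ ⨅ₙ Θ n (pc s) s`. -/
theorem transportLemmaMono : ∀ (Θ : ℕ → ℝ → ℝ → ℝ) (pc : ℝ → ℝ) (a : ℝ → ℝ → ℝ) (lo hi ρ L : ℝ), 0 < lo → lo < hi → hi < 1 → 0 < ρ → (∀ n, ContDiffOn ℝ 1 (fun x : ℝ × ℝ => Θ n x.1 x.2) (Set.Ioo 0 1 ×ˢ Set.Ioo 0 1)) → (∀ n t, Monotone (fun p => Θ n p t)) → (∀ n p, Monotone (fun t => Θ n p t)) → (∀ p t, Antitone (fun n => Θ n p t)) → (∀ n p t, 0 ≤ Θ n p t) → ContinuousOn pc (Set.Icc lo hi) → (∀ t ∈ Set.Icc lo hi, ρ < pc t ∧ pc t + ρ < 1) → (∀ t ∈ Set.Icc lo hi, ∀ p : ℝ,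 (p < pc t → (⨅ n, Θ n p t) = 0) ∧ (pc t < p → 0 < ⨅ n, Θ n p t)) → ContinuousOn (fun x : ℝ × ℝ => a x.1 x.2) {x : ℝ × ℝ | x.2 ∈ Set.Icc lo hi ∧ pc x.2 ≤ x.1 ∧ x.1 ≤ pc x.2 + ρ} → (∀ t ∈ Set.Icc lo hi, ∀ p q : ℝ, pc t ≤ p → p ≤ pc t + ρ → pc t ≤ q → q ≤ pc t + ρ → |a p t - a q t| ≤ L * |p - q|) → (∀ η > (0 : ℝ), ∃ m : ℕ, ∀ n ≥ m, ∀ t ∈ Set.Icc lo hi, ∀ p : ℝ, pc t ≤ p → p ≤ pc t + ρ → |deriv (fun s => Θ n p s) t - a p t * deriv (fun q => Θ n q t) p| ≤ η * deriv (fun q => Θ n q t) p) → (∀ η > (0 : ℝ), ∃ δ > (0 : ℝ), ∃ m : ℕ, ∀ n ≥ m, ∀ t ∈ Set.Icc lo hi, ∀ p : ℝ, pc t - δ ≤ p → p ≤ pc t → (a (pc t) t - η) * deriv (fun q => Θ n q t) p ≤ deriv (fun s => Θ n p s) t) → ∀ s t : ℝ, s ∈ Set.Icc lo hi → t ∈ Set.Icc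 lo hi → s ≤ t → (⨅ n, Θ n (pc t) t) ≤ ⨅ n, Θ n (pc s) s := by
  intro Θ pc a lo hi ρ L hlo hlohi hhi hρ hC1 hmp _hmt hanti hnn hpc hcollar hthr ha hL hexR hexL
    s t hs ht hst
  -- moduli on the right collar and of the curve
  obtain ⟨⟨A, hA⟩, hω⟩ := rightCollar_moduli pc a lo hi ρ hρ.le hpc ha
  have hτ := pc_modulus pc lo hi hpc
  -- the forward one-sided upper fence, then one-sided level transport
  have hUF := upperFenceMono Θ pc a lo hi ρ A hlo hlohi hhi hρ hC1 hmp hanti hnn hcollar hthr hA hω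
    hτ hexR hexL
  have hLT := levelTransportMono Θ pc a lo hi ρ L A hlo hlohi hhi hρ hC1 hmp hanti hnn hcollar hA hω
    hτ hL hexR hUF
  obtain ⟨ε₀, hε₀, hε⟩ := hLT s t hs.1 hst ht.2
  -- ε ↓ 0 through right-continuity of the level function at `pc s`
  have hcont : ∀ n, ContinuousOn (fun x : ℝ × ℝ => Θ n x.1 x.2) (Set.Ioo 0 1 ×ˢ Set.Ioo 0 1) :=
    fun n => (hC1 n).continuousOn
  have hs' : s ∈ Set.Ioo (0 : ℝ) 1 := ⟨by linarith [hs.1], by linarith [hs.2]⟩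
  have hpcs : pc s ∈ Set.Ioo (0 : ℝ) 1 := by
    obtain ⟨h1, h2⟩ := hcollar s hs
    exact ⟨by linarith, by linarith⟩
  have hR : Tendsto (fun q => ⨅ n, Θ n q s) (𝓝[>] (pc s)) (𝓝 (⨅ n, Θ n (pc s) s)) :=
    rightContinuity Θ s hcont hmp hnn hs' (pc s) hpcs
  refine ge_of_tendsto hR ?_
  refine Filter.eventually_of_mem (Ioo_mem_nhdsGT (show pc s < pc s + ε₀ by linarith)) ?_
  intro q hq
  have h := hε (q - pc s) (by linarith [hq.1]) (by linarith [hq.2])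
  have e : pc s + (q - pc s) = q := by ring
  rw [e] at h
  exact h

end Summit.CriticalPhenomena.PercolationContinuityZ3.Theorems.SubcritExchangeUniformity.TransportMono
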